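import Summits.QuantumFields.YangMills.Theorems.BalabanUVNodesN12Prop1OfGaugeLetterAndChartConstantsLoc
import Summits.QuantumFields.YangMills.Theorems.BalabanUVNodesN12GaugeLetterLocExplicit

/-!
# BalabanUVNodes ∕ N12 — PROPOSITION 1 [IV] AT PRINT'S (1.74) OBJECT ON THE COERCIVE ROAD, CLASS ROAD («(viii)»): (iii) with the localised gauge letter (σ)_N DISCHARGED BY NAME from
# dag-n12-w3's explicit class-based producer `exists_gaugeLetterLoc_atRecord_explicit` — fixed (guard-independent) tolerances `T i`, pinned; the chart constants and the localised
# chart body stay binders so that the numerics `hsm` at `T i` can be stated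

Cell `pub-ymgap` (HUMAN RULINGS D-0062 ∕ D-0149 ∕ D-0154), WIDTH SEAT `pub-ymgap-dag-n12-w5` g5 (node N12 = [B15]; key K1⁹ `stmt-QuantumFields-27364`, `--kind proof --supports …
--as helper`; count-neutral).  dag-n12-w3 g4's OFFER (pub-ymgap INBOX 2026-08-28T17:12:51Z) accepted (17:14:05Z): the CLASS-road producer keys on the FIXED-tolerance socket (iii)
(`…N12Prop1OfGaugeLetterAndChartConstantsLoc`, p637386), not on the ∀δ∃e road (iv)–(vii), because its tolerance does not shrink with the guard.  THEOREMS ONLY (0 `def`, 0 `instance`,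
0 `sorry`); composition BY NAME of (iii) and `N12GaugeLetterLocExplicit.exists_gaugeLetterLoc_atRecord_explicit` (p652858).

WHAT CHANGES vs (iii).  GONE: `{δc δin} hδc0 hδin0 hσN`.  PINNED: `δc i = δin i := T i := max (ρn i) (((2ℓ_{k_i}+1+m·L^{k_i})²∕4)·(εreg·η₀²) + m·(6κ·Σ_{l<k_i} L^l) + m·ρn i)`
(`κ = (((d+2)L)²∕4)·(2εregL²)`, `m = 3·d·((L−1)∕2)+5`) — so `hsmall` becomes `hsmallT : T i ≤ ρs i` and `hsm` becomes `hsmT` (the same text at `T i`): explicit CONDITIONS on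
`εreg`, `ρn i` and the chart constants (the closers' numerics; `B15Prop1NumericsThresholds` §3 names the threshold).  NEW (σ-side, displayed): per instance a level guard `c i` with
`hkc hc`, the radius numerics `hMrad`, the geometry `hGN` (gN1, at the region box) `hN1` (gN2) `hGmem` (member shadows in the region box), and the uniform class numerics `hεpos hα3 hα2
haN hM₁`.  Everything else VERBATIM (iii) (incl. the chart constants + `hchartN` binders, `hγle`, bookkeeping, `h15T`).

HONEST FRAMING.  Composition by name + sign bookkeeping; nothing of Bałaban's is asserted; (J0′), the chart body, the [15] Theorem-1 letter, the numerics and the geometry stay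
DISPLAYED; SCALING CAVEAT travels with the socket (dag-n12-c g20 ∕ dag-n12-w3 g4, INBOX 2026-08-28T15:50Z: the scale-0 class tolerance `∼ L^{2k}·εreg` is crude — `hsmT` is
satisfiable only for `εreg` far below the instance thresholds); bondwise road = simply-connected normalisable `Ω₁(Z_i)` (LOCATED-GEOM v3); count-neutral; N12 NOT discharged; K1⁹ NOT
closed; counts unmoved; one finite 𝕋⁴ programme at fixed `ε = L^{-K}` — R4 closes only the conditional rung `BalabanLadder.UV`; no summit statement is proved here and NOT the
Yang–Mills mass gap (Clay); nothing continuum ∕ ℝ⁴ ∕ OS.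

References: [Balaban1989LargeFieldI] CMP 122 (1989) 175–202, (1.74) p.192, Prop. 1 (1.77)–(1.78) p.194; [Balaban1989LargeFieldII] CMP 122 (1989) 355–392, p.357, (1.7)–(1.9) p.358,
(1.12)–(1.13) p.359; [Balaban1985Variational] CMP 102 (1985) 277–309, (3)–(4) p.278, Thm 1 (8) p.279, (16)–(18) p.280, Prop. 9 (190) p.309; [Balaban1985Averaging] CMP 98 (1985) 17–51,
Prop. 2; [Balaban1988Convergent] CMP 119 (1988) 243–285, (2.2) p.255, (2.11)–(2.14) pp.256–257.
-/

noncomputable section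

open Set Finset Metric Filter
open scoped BigOperators Matrix RealInnerProductSpace Real InnerProductSpace Topology Matrix.Norms.L2Operator

namespace Summit.QuantumFields.YangMills.BalabanUVNodes.N12Prop1OfGaugeLetterExplicitLoc

open Literature.MathematicalPhysics.QuantumFieldTheory.Balaban1983to89
open T4Continuum B15DeterminingSets GaugeField B16Sect1Backgrounds B15Prop1Carrier B8Eq17ClassAkV1 BlockAveraging
open B15Prop1SliceTaylorCalculus
open B15Prop1ChartCalculusSU2 (E3)
open T4CubeChartGnomonic (SU2)
open B15Prop1ChartSU2 (su2Chart)
open B15Prop1SliceCoordinates (GaugeSlice ιA freeBonds)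
open B15Prop1AnalyticExtClause (cplxVec anExt)
open T4AdjointCovarianceUnitary (lieSU)
open T4AxialGaugeSmallField (castSite boxPlaqs boxBonds)
open B6BondElimination (unitVec)
open B6TreeGaugePoincare (curl)
open B16Eq18Proof (box mem_box)
open B15Extension193 (extend)
open B15ShellGauge193 (shellGauge)
open B14.Eq213MaximalDomains (side)
open B14.Eq213DetSet B14.Eq216Concrete B15Sect1Instances B15Eq177GaugeInvariance B15Eq177ValueInvariance B15Eq177ValueInvarianceCoDiv B16Sect1Wilson
open B14.Eq22Determines (blockIter IsBlockUnion)
open Literature.MathematicalPhysics.QuantumFieldTheory.BalabanImbrieJaffe1984to88.BIJ85Eq453GaugeField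
open Node00 (expChart msChart constrCard)
open B5Eq118OneStroke (iterBlockOf)
open ExpMeanLog (deltaSU)

variable {F : T4Family}
set_option maxHeartbeats 400000 in
/-- ★★★ **PROPOSITION 1 [IV] AT PRINT'S (1.74) OBJECT — COERCIVE ROAD — (iii) WITH THE LOCALISED GAUGE LETTER DISCHARGED BY dag-n12-w3's EXPLICIT CLASS-ROAD PRODUCER, TOLERANCES
PINNED TO `T i`.**  See the module docstring for the binder delta.  Proof: (iii) at `δc = δin := T`, `hσN := exists_gaugeLetterLoc_atRecord_explicit …` per instance, `max_self` bridges.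
[cite: Balaban1989LargeFieldI, (1.74) p.192, Prop. 1 (1.77)–(1.78) p.194 (incl. the last clause), (1.79) p.195; Balaban1989LargeFieldII, p.357, (1.7)–(1.9) p.358, (1.12)–(1.13) p.359;
Balaban1985Variational, (3)–(4) p.278, Thm 1 (8) p.279, (16)–(18) p.280, Prop. 9 (190) p.309; Balaban1988Convergent, (2.2) p.255, (2.12)–(2.14) pp.256–257] -/
theorem exists_domain_prop1Printed_lfVarOn_std_su2_box_intrinsic_analytic_atZSeqCoPRecord_ofThm1TorusClass_ofMinimiserFamily_ofGaugeLetterExplicit_ofChartConstantsN_ofCoercive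
    (ν : Node00.Stage7Numerics) (Kt : ℕ) (hd3 : 3 ≤ (F.P Kt).d) (h0 : 0 < (F.P Kt).d) {ι : Type}
    (Z Λ : ι → Set (Site (F.P Kt) 0)) (k : ι → ℕ) (M : ι → ℝ) (hk0 : ∀ i, 0 < k i) (hk : ∀ i, k i ≤ (F.P Kt).m + (F.P Kt).K)
    (eR : ι → ℝ) (heR : ∀ i, 0 < eR i)
    (T : ∀ i, Finset (PBond (F.P Kt) (k i)))
    (lo hi : ι → Fin (F.P Kt).d → ℤ) (n : ι → ℕ) (hn : ∀ i κ, hi i κ ≤ lo i κ + n i) (hN : ∀ i, n i + 2 < (F.P Kt).sitesPerDir (k i))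
    (hbox : ∀ i, pts (k i) (Λ i) = (castSite '' Set.Icc (lo i) (hi i) : Set (Site (F.P Kt) (k i))))
    (hZ : ∀ i, (boxPlaqs (lo i - 1) (hi i + 1) : Set (Plaq (F.P Kt) (k i))) ⊆ plaqsInside (pts (k i) (Z i)))
    (hTG0 : ∀ i, T i = (box (fun κ => (hi i κ - lo i κ + 1).toNat) (lo i)).image fun x =>
      (⟨castSite (x - unitVec ⟨0, h0⟩), ⟨0, h0⟩⟩ : PBond (F.P Kt) (k i)))
    (hN5 : ∀ i κ, ((hi i κ - lo i κ + 1).toNat : ℤ) + 5 < (F.P Kt).sitesPerDir (k i))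
    (K : ι → ℕ) (hK1 : ∀ i, 1 ≤ K i) (hKn : ∀ i κ, (hi i κ - lo i κ + 1).toNat ≤ K i)
    (ext : ∀ i, GaugeField (F.P Kt) (k i) SU2 → GaugeField (F.P Kt) (k i) SU2)
    (hext : ∀ i Vk, ext i Vk = extend (pts (k i) (Λ i)) (shellGauge Vk (lo i) (hi i)) Vk)
    (hlohi : ∀ i, lo i ≤ hi i)
    -- the REGION parallelepipeds of the normalisation and the datum tolerances
    (LO HI : ι → Fin (F.P Kt).d → ℤ) (hLO : ∀ i, LO i ≤ lo i - 1) (hHI : ∀ i, hi i + 1 ≤ HI i) (n' : ι → ℕ) (hn' : ∀ i κ, HI i κ ≤ LO i κ + n' i)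
    (hn'N : ∀ i, n' i < (F.P Kt).sitesPerDir (k i)) (hR' : ∀ i, (boxPlaqs (LO i) (HI i) : Set (Plaq (F.P Kt) (k i))) ⊆ plaqsInside (pts (k i) (Z i)))
    (ρn : ι → ℝ)
    (hρn : ∀ i, (((F.P Kt).d : ℝ) * n' i + 1) * ((((F.P Kt).d - 1 : ℕ) : ℝ) * n' i * ((12 * (F.P Kt).d * (n i + 2) ^ 2 + 1) * eR i)
      + 3 * (F.P Kt).d * (n i + 2) ^ 2 * eR i) ≤ ρn i)
    {γ cJ bx : ℝ} (hγ : 0 < γ) (hcJ : 0 ≤ cJ) (hbx : 0 ≤ bx)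
    (hbxM : ∀ i, 12 * ((F.P Kt).d : ℝ) * ((n i : ℝ) + 2) ^ 2 ≤ bx * (M i) ^ 2)
    {R 𝓐₀ : ι → ℝ} (hM : ∀ i, 1 ≤ (M i)) (hR : ∀ i, 0 < R i)
    -- (J0′), R-EXPLICIT: per instance one radius and one bound for every base field of the strict guard
    (hMin : ∀ i Vk, PlaqSmallOn (plaqsInside (pts (k i) (Z i ∩ (Λ i)ᶜ))) (eR i) Vk →
      ∃ Ũ : VecField (F.P Kt) (k i) (EuclideanSpace ℂ (Fin 3)) × VecField (F.P Kt) (k i) (EuclideanSpace ℂ (Fin 3)) →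
          PBond (F.P Kt) 0 → Matrix (Fin 2) (Fin 2) ℂ,
        (∀ b a c, DifferentiableOn ℂ (fun z => Ũ z b a c) (ball 0 (R i))) ∧
        (∀ z ∈ ball (0 : VecField (F.P Kt) (k i) (EuclideanSpace ℂ (Fin 3)) × VecField (F.P Kt) (k i) (EuclideanSpace ℂ (Fin 3))) (R i),
          ∀ b a c, ‖Ũ z b a c‖ ≤ 𝓐₀ i) ∧
        ∀ p B' : VecField (F.P Kt) (k i) E3, ‖p‖ < R i → ‖B'‖ < R i → ∃ U' : GaugeField (F.P Kt) 0 SU2,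
          (∀ b, Ũ (cplxVec p, cplxVec B') b = ((U' b : SU2) : Matrix (Fin 2) (Fin 2) ℂ)) ∧
            IsMinimizer (Node00.avOfRecord F 2 Kt) (Node00.regMSCoPOfRecord F 2 ν Kt (k i) (maxDomT ν.M₁ (Z i))) (Bj ν.M₁ (Z i) (k i))
              (avgFamily (Node00.avOfRecord F 2 Kt) (qsstarGIter0 (k i) (expMul su2Chart B' (ext i (expMul su2Chart p Vk))))) U')
    -- the CHART CONSTANTS of dag-n12-w4's `chartLetter_of_letters_N` (binders, so that `hsm` can be stated); the tolerances are PINNED to the explicit producer's `T i` (docstring)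
    (ρs Cμ Cρ C₂ Cτ : ι → ℝ) (hCμ : ∀ i, 0 ≤ Cμ i) (hCρ : ∀ i, 0 ≤ Cρ i) (hC₂ : ∀ i, 0 ≤ C₂ i)
    (hsmallT : ∀ i, max (ρn i) ((((2 * (∑ l ∈ Finset.range (k i + 1), ((F.P Kt).d * (((F.P Kt).L ^ l - 1) / 2) + 1)) + 1 + (3 * ((F.P Kt).d * (((F.P Kt).L - 1) / 2)) + 5) * (F.P Kt).L ^ (k i) : ℕ) : ℝ)) ^ 2 / 4 * (ν.εreg * (F.P Kt).eta 0 ^ 2) + ((3 * ((F.P Kt).d * (((F.P Kt).L - 1) / 2)) + 5 : ℕ) : ℝ) * (6 * ((((((F.P Kt).d + 2) * (F.P Kt).L : ℕ) : ℝ) ^ 2 / 4) * (2 * (ν.εreg * (F.P Kt).L ^ 2))) * ∑ l ∈ Finset.range (k i), ((F.P Kt).L : ℝ) ^ l) + ((3 * ((F.P Kt).d * (((F.P Kt).L - 1) / 2)) + 5 : ℕ) : ℝ) * ρn i) ≤ ρs i) (h𝓐₀ : ∀ i, 0 ≤ 𝓐₀ i)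
    -- LOCATED-CIN (R-a): per instance the bond neighbourhood on which the `inputs` near-flatness is delivered ∕ asked
    (N : ι → Set (PBond (F.P Kt) 0))
    -- (σ)_N DISCHARGED BY NAME from dag-n12-w3 g4's `N12GaugeLetterLocExplicit.exists_gaugeLetterLoc_atRecord_explicit` (CLASS road, fixed tolerance): its displayed inputs —
    -- NUMERICS (level guard ∕ no wrapping ∕ radii ∕ the class threshold `εreg`) and GEOMETRY ((gN1) `hGN` at the region box, (gN2) `hN1`, the member-shadow letter `hGmem`)
    (c : ι → ℕ) (hkc : ∀ i, k i + c i ≤ (F.P Kt).m + (F.P Kt).K) (hc : ∀ i, 4 * (F.P Kt).d + (3 * ((F.P Kt).d * (((F.P Kt).L - 1) / 2)) + 5) + 3 < 2 * (F.P Kt).L ^ (c i))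
    (hMrad : (4 * (F.P Kt).d + (3 * ((F.P Kt).d * (((F.P Kt).L - 1) / 2)) + 5)) * (F.P Kt).L ^ 2 + 2 * (F.P Kt).d * (F.P Kt).L + 12 ≤ ν.M₁)
    (hGN : ∀ i, ∀ b ∈ N i, (b.src ∉ maxDomT ν.M₁ (Z i) 1 ∨ b.tgt ∉ maxDomT ν.M₁ (Z i) 1) → blockIter (k i) b.tgt ≠ blockIter (k i) b.src →
      (⟨blockIter (k i) b.src, b.dir⟩ : PBond (F.P Kt) (k i)) ∈ (boxBonds (LO i) (HI i) : Set (PBond (F.P Kt) (k i))))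
    (hN1 : ∀ i, ∀ p : Plaq (F.P Kt) 0, ((⟨p.src, p.μ⟩ : PBond (F.P Kt) 0) ∈ {b : PBond (F.P Kt) 0 | b.src ∈ maxDomT ν.M₁ (Z i) 1} ∨
        (⟨p.src.shift p.μ, p.ν⟩ : PBond (F.P Kt) 0) ∈ {b : PBond (F.P Kt) 0 | b.src ∈ maxDomT ν.M₁ (Z i) 1} ∨
        (⟨p.src.shift p.ν, p.μ⟩ : PBond (F.P Kt) 0) ∈ {b : PBond (F.P Kt) 0 | b.src ∈ maxDomT ν.M₁ (Z i) 1} ∨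
        (⟨p.src, p.ν⟩ : PBond (F.P Kt) 0) ∈ {b : PBond (F.P Kt) 0 | b.src ∈ maxDomT ν.M₁ (Z i) 1}) →
      (⟨p.src, p.μ⟩ : PBond (F.P Kt) 0) ∈ N i ∧ (⟨p.src.shift p.μ, p.ν⟩ : PBond (F.P Kt) 0) ∈ N i ∧
        (⟨p.src.shift p.ν, p.μ⟩ : PBond (F.P Kt) 0) ∈ N i ∧ (⟨p.src, p.ν⟩ : PBond (F.P Kt) 0) ∈ N i)
    (hεpos : 0 < ν.εreg)
    (hα3 : (143 * (((((F.P Kt).d + 4 : ℕ) : ℝ)) ^ 2 / 4) ^ 2) * (ν.εreg * (F.P Kt).L ^ 2) ≤ 1 / 3)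
    (hα2 : 2 * (ν.εreg * (F.P Kt).L ^ 2) ≤ 2 * deltaSU (Fin 2) / ((((F.P Kt).d + 4) * (F.P Kt).L : ℕ) : ℝ) ^ 2)
    (haN : (((((F.P Kt).d + 2) * (F.P Kt).L : ℕ) : ℝ) ^ 2 / 4) * (2 * (ν.εreg * (F.P Kt).L ^ 2)) < deltaSU (Fin 2))
    (hM₁ : (((F.P Kt).d + 4) * (F.P Kt).L + 6) * (F.P Kt).L ^ 2 ≤ ν.M₁)
    (hGmem : ∀ i, ∀ lv ≤ k i, ∀ c' ∈ bondsOf ((Bj ν.M₁ (Z i) (k i) : DetSet (F.P Kt)) lv), blockIter (k i) (embIter lv c'.tgt) ≠ blockIter (k i) (embIter lv c'.src) →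
      (⟨blockIter (k i) (embIter lv c'.src), c'.dir⟩ : PBond (F.P Kt) (k i)) ∈ (boxBonds (LO i) (HI i) : Set (PBond (F.P Kt) (k i))))
    -- (χ)_N AT THE CHART CONSTANTS: the body of dag-n12-w4's `chartLetter_of_letters` after its `∃ ρs Cμ Cρ C₂ Cτ`, per instance, with its `inputs` PREMISE LOCALISED to
    -- `N i` — a BINDER until `chartLetter_of_letters_N` lands (then supplied by name + `choose`, as in p631882 §1)
    (hchartN : ∀ i,
      ∀ (ext' : GaugeField (F.P Kt) (k i) SU2 → GaugeField (F.P Kt) (k i) SU2) (Vk : GaugeField (F.P Kt) (k i) SU2) {R' A' : ℝ}, 0 < R' → 0 ≤ A' →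
      ∀ {δ' δi' : ℝ}, 0 ≤ δ' → 0 ≤ δi' → 0 < max δ' δi' → max δ' δi' ≤ ρs i →
      ∀ (U₀ : GaugeField (F.P Kt) 0 SU2) (Xf : GaugeSlice (pts (k i) (Λ i)) (T i) E3 → PBond (F.P Kt) 0 → lieSU (Fin 2)),
      IsMinimizer (Node00.avOfRecord F 2 Kt) (Node00.regMSCoPOfRecord F 2 ν Kt (k i) (maxDomT ν.M₁ (Z i))) (Bj ν.M₁ (Z i) (k i))
        (avgFamily (Node00.avOfRecord F 2 Kt) (qsstarGIter0 (k i) (ext' Vk))) U₀ →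
      (∀ p : Plaq (F.P Kt) 0, ((⟨p.src, p.μ⟩ : PBond (F.P Kt) 0) ∈ {b : PBond (F.P Kt) 0 | b.src ∈ maxDomT ν.M₁ (Z i) 1} ∨
          (⟨p.src.shift p.μ, p.ν⟩ : PBond (F.P Kt) 0) ∈ {b : PBond (F.P Kt) 0 | b.src ∈ maxDomT ν.M₁ (Z i) 1} ∨
          (⟨p.src.shift p.ν, p.μ⟩ : PBond (F.P Kt) 0) ∈ {b : PBond (F.P Kt) 0 | b.src ∈ maxDomT ν.M₁ (Z i) 1} ∨
          (⟨p.src, p.ν⟩ : PBond (F.P Kt) 0) ∈ {b : PBond (F.P Kt) 0 | b.src ∈ maxDomT ν.M₁ (Z i) 1}) →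
        ‖((U₀ ⟨p.src, p.μ⟩ : SU2) : Matrix (Fin 2) (Fin 2) ℂ) - 1‖ ≤ δ' ∧ ‖((U₀ ⟨p.src.shift p.μ, p.ν⟩ : SU2) : Matrix (Fin 2) (Fin 2) ℂ) - 1‖ ≤ δ' ∧
          ‖((U₀ ⟨p.src.shift p.ν, p.μ⟩ : SU2) : Matrix (Fin 2) (Fin 2) ℂ) - 1‖ ≤ δ' ∧ ‖((U₀ ⟨p.src, p.ν⟩ : SU2) : Matrix (Fin 2) (Fin 2) ℂ) - 1‖ ≤ δ') →
      (∀ b ∈ inputs (Bj ν.M₁ (Z i) (k i)), b ∈ N i → ‖((U₀ b : SU2) : Matrix (Fin 2) (Fin 2) ℂ) - 1‖ ≤ δi') →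
      Xf 0 = 0 → ContDiffAt ℝ 2 Xf 0 →
      (∀ᶠ Y in 𝓝 (0 : GaugeSlice (pts (k i) (Λ i)) (T i) E3),
        IsMinimizer (Node00.avOfRecord F 2 Kt) (Node00.regMSCoPOfRecord F 2 ν Kt (k i) (maxDomT ν.M₁ (Z i))) (Bj ν.M₁ (Z i) (k i))
          (avgFamily (Node00.avOfRecord F 2 Kt) (qsstarGIter0 (k i) (expMul su2Chart (ιA (pts (k i) (Λ i)) (T i) Y) (ext' Vk)))) (expChart U₀ (Xf Y))) →
      (∀ (X : GaugeSlice (pts (k i) (Λ i)) (T i) E3) (b : PBond (F.P Kt) 0),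
        ‖((fderiv ℝ Xf 0 X b : lieSU (Fin 2)) : Matrix (Fin 2) (Fin 2) ℂ)‖ ≤ 8 * A' / R' * ‖X‖ ∧ ‖fderiv ℝ Xf 0 X b‖ ≤ 12 * A' / R' * ‖X‖) →
      (∀ (X : GaugeSlice (pts (k i) (Λ i)) (T i) E3) (b : PBond (F.P Kt) 0), b.src ∉ maxDomT ν.M₁ (Z i) 1 → fderiv ℝ Xf 0 X b = 0) →
      ∃ (Ψ₂ : (PBond (F.P Kt) 0 → lieSU (Fin 2)) →L[ℝ] (PBond (F.P Kt) 0 → lieSU (Fin 2)) →L[ℝ] (Fin (constrCard (Bj ν.M₁ (Z i) (k i)) (k i)) → lieSU (Fin 2)))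
        (lam : (Fin (constrCard (Bj ν.M₁ (Z i) (k i)) (k i)) → lieSU (Fin 2)) →L[ℝ] ℝ)
        (p : Seminorm ℝ (PBond (F.P Kt) 0 → lieSU (Fin 2))) (q : (Fin (constrCard (Bj ν.M₁ (Z i) (k i)) (k i)) → lieSU (Fin 2)) → ℝ)
        (Lf : (PBond (F.P Kt) 0 → lieSU (Fin 2)) →L[ℝ] (Fin (constrCard (Bj ν.M₁ (Z i) (k i)) (k i)) → lieSU (Fin 2)))
        (Rf : (Fin (constrCard (Bj ν.M₁ (Z i) (k i)) (k i)) → lieSU (Fin 2)) → PBond (F.P Kt) 0 → lieSU (Fin 2)),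
        HasFDerivAt (fun Y => fderiv ℝ (msChart F 2 Kt (k i) (Bj ν.M₁ (Z i) (k i)) (avgFamily (Node00.avOfRecord F 2 Kt) (qsstarGIter0 (k i) (ext' Vk))) U₀) Y) Ψ₂ 0 ∧
        (∀ᶠ Y in 𝓝 (0 : PBond (F.P Kt) 0 → lieSU (Fin 2)),
          DifferentiableAt ℝ (msChart F 2 Kt (k i) (Bj ν.M₁ (Z i) (k i)) (avgFamily (Node00.avOfRecord F 2 Kt) (qsstarGIter0 (k i) (ext' Vk))) U₀) Y) ∧
        fderiv ℝ (fun Y : PBond (F.P Kt) 0 → lieSU (Fin 2) => wilsonAction4 (expChart U₀ Y)) 0 =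
          lam.comp (fderiv ℝ (msChart F 2 Kt (k i) (Bj ν.M₁ (Z i) (k i)) (avgFamily (Node00.avOfRecord F 2 Kt) (qsstarGIter0 (k i) (ext' Vk))) U₀) 0) ∧
        (∀ Y : PBond (F.P Kt) 0 → lieSU (Fin 2), ∑ b, ‖(Y b : Matrix (Fin 2) (Fin 2) ℂ)‖ ^ 2 ≤ p Y ^ 2) ∧
        (∀ v, Lf (Rf v) = v) ∧ (∀ v, p (Rf v) ≤ Cρ i * q v) ∧
        ∀ X : GaugeSlice (pts (k i) (Λ i)) (T i) E3,
          q (fderiv ℝ (msChart F 2 Kt (k i) (Bj ν.M₁ (Z i) (k i)) (avgFamily (Node00.avOfRecord F 2 Kt) (qsstarGIter0 (k i) (ext' Vk))) U₀) 0 (fderiv ℝ Xf 0 X)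
              - Lf (fderiv ℝ Xf 0 X)) ≤ (C₂ i * max δ' δi') * p (fderiv ℝ Xf 0 X) ∧
          lam (Ψ₂ (fderiv ℝ Xf 0 X) (fderiv ℝ Xf 0 X)) ≤ (Cμ i * max δ' δi') * p (fderiv ℝ Xf 0 X) ^ 2 ∧
          p (fderiv ℝ Xf 0 X) ≤ (12 * A' / R' * Real.sqrt (Nat.card {b : PBond (F.P Kt) 0 // b.src ∈ maxDomT ν.M₁ (Z i) 1})) * ‖X‖ ∧
          ∃ m : ℝ, (∀ w', Lf w' = fderiv ℝ (msChart F 2 Kt (k i) (Bj ν.M₁ (Z i) (k i)) (avgFamily (Node00.avOfRecord F 2 Kt) (qsstarGIter0 (k i) (ext' Vk))) U₀) 0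
                (fderiv ℝ Xf 0 X) →
              m ≤ fderiv ℝ (fun Y => fderiv ℝ (fun Y : PBond (F.P Kt) 0 → lieSU (Fin 2) => wilsonAction4 (expChart (1 : GaugeField (F.P Kt) 0 SU2) Y)) Y) 0 w' w') ∧
            (((F.P Kt).L : ℝ) ^ (F.P Kt).d) ^ (k i) / ((((F.P Kt).L : ℝ)) ^ 2 * ((F.P Kt).L : ℝ) ^ 2) ^ (k i) *
                (∑ z ∈ box (fun κ => (hi i κ - lo i κ + 1).toNat + 3) (fun κ => lo i κ - 2), ∑ μ : Fin (F.P Kt).d, ∑ a : Fin 3,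
                  curl (fun b => ιA (pts (k i) (Λ i)) (T i) X (⟨castSite b.1, b.2⟩ : PBond (F.P Kt) (k i)) a) z ⟨0, h0⟩ μ ^ 2)
              - ((((F.P Kt).L : ℝ) ^ (F.P Kt).d) ^ (k i) / ((((F.P Kt).L : ℝ)) ^ 2 * ((F.P Kt).L : ℝ) ^ 2) ^ (k i)
                  * (16 * (((F.P Kt).d : ℝ) + 1) * (Cτ i * max δ' δi'))) * ‖X‖ ^ 2 ≤ m)
    -- numerics IN THE CHART CONSTANTS AT THE PINNED TOLERANCE `T i` (`γ₀ := 1`: dag-n12-w4's per-instance `γ₀(k) = (L^d)^k∕(L²·L²)^k` is `1` at `d = 4`): the assembled `Cerr i` is small, the positivity constant fits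
    (hsmT : ∀ i, (32 * (((F.P Kt).d : ℝ) - 1) * (max (ρn i) ((((2 * (∑ l ∈ Finset.range (k i + 1), ((F.P Kt).d * (((F.P Kt).L ^ l - 1) / 2) + 1)) + 1 + (3 * ((F.P Kt).d * (((F.P Kt).L - 1) / 2)) + 5) * (F.P Kt).L ^ (k i) : ℕ) : ℝ)) ^ 2 / 4 * (ν.εreg * (F.P Kt).eta 0 ^ 2) + ((3 * ((F.P Kt).d * (((F.P Kt).L - 1) / 2)) + 5 : ℕ) : ℝ) * (6 * ((((((F.P Kt).d + 2) * (F.P Kt).L : ℕ) : ℝ) ^ 2 / 4) * (2 * (ν.εreg * (F.P Kt).L ^ 2))) * ∑ l ∈ Finset.range (k i), ((F.P Kt).L : ℝ) ^ l) + ((3 * ((F.P Kt).d * (((F.P Kt).L - 1) / 2)) + 5 : ℕ) : ℝ) * ρn i)) + Cμ i * max ((max (ρn i) ((((2 * (∑ l ∈ Finset.range (k i + 1), ((F.P Kt).d * (((F.P Kt).L ^ l - 1) / 2) + 1)) + 1 + (3 * ((F.P Kt).d * (((F.P Kt).L - 1) / 2)) + 5) * (F.P Kt).L ^ (k i) : ℕ)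 : ℝ)) ^ 2 / 4 * (ν.εreg * (F.P Kt).eta 0 ^ 2) + ((3 * ((F.P Kt).d * (((F.P Kt).L - 1) / 2)) + 5 : ℕ) : ℝ) * (6 * ((((((F.P Kt).d + 2) * (F.P Kt).L : ℕ) : ℝ) ^ 2 / 4) * (2 * (ν.εreg * (F.P Kt).L ^ 2))) * ∑ l ∈ Finset.range (k i), ((F.P Kt).L : ℝ) ^ l) + ((3 * ((F.P Kt).d * (((F.P Kt).L - 1) / 2)) + 5 : ℕ) : ℝ) * ρn i))) ((max (ρn i) ((((2 * (∑ l ∈ Finset.range (k i + 1), ((F.P Kt).d * (((F.P Kt).L ^ l - 1) / 2) + 1)) + 1 + (3 * ((F.P Kt).d * (((F.P Kt).L - 1) / 2)) + 5) * (F.P Kt).L ^ (k i) : ℕ) : ℝ)) ^ 2 / 4 * (ν.εreg * (F.P Kt).eta 0 ^ 2) + ((3 * ((F.P Kt).d * (((F.P Kt).L - 1) / 2)) + 5 : ℕ) : ℝ) * (6 * ((((((F.P Kt).d + 2) * (F.P Kt).L : ℕ) : ℝ) ^ 2 / 4) * (2 * (ν.εreg * (F.P Kt).L ^ 2))) * ∑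 l ∈ Finset.range (k i), ((F.P Kt).L : ℝ) ^ l) + ((3 * ((F.P Kt).d * (((F.P Kt).L - 1) / 2)) + 5 : ℕ) : ℝ) * ρn i)))
        + 16 * (((F.P Kt).d : ℝ) - 1) * (Cρ i * (C₂ i * max ((max (ρn i) ((((2 * (∑ l ∈ Finset.range (k i + 1), ((F.P Kt).d * (((F.P Kt).L ^ l - 1) / 2) + 1)) + 1 + (3 * ((F.P Kt).d * (((F.P Kt).L - 1) / 2)) + 5) * (F.P Kt).L ^ (k i) : ℕ) : ℝ)) ^ 2 / 4 * (ν.εreg * (F.P Kt).eta 0 ^ 2) + ((3 * ((F.P Kt).d * (((F.P Kt).L - 1) / 2)) + 5 : ℕ) : ℝ) * (6 * ((((((F.P Kt).d + 2) * (F.P Kt).L : ℕ) : ℝ) ^ 2 / 4) * (2 * (ν.εreg * (F.P Kt).L ^ 2))) * ∑ l ∈ Finset.range (k i), ((F.P Kt).L : ℝ) ^ l) + ((3 * ((F.P Kt).d * (((F.P Kt).L - 1) / 2)) + 5 : ℕ) : ℝ) * ρn i))) ((max (ρn i) ((((2 * (∑ l ∈ Finset.range (k i + 1), ((F.P Kt).d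 * (((F.P Kt).L ^ l - 1) / 2) + 1)) + 1 + (3 * ((F.P Kt).d * (((F.P Kt).L - 1) / 2)) + 5) * (F.P Kt).L ^ (k i) : ℕ) : ℝ)) ^ 2 / 4 * (ν.εreg * (F.P Kt).eta 0 ^ 2) + ((3 * ((F.P Kt).d * (((F.P Kt).L - 1) / 2)) + 5 : ℕ) : ℝ) * (6 * ((((((F.P Kt).d + 2) * (F.P Kt).L : ℕ) : ℝ) ^ 2 / 4) * (2 * (ν.εreg * (F.P Kt).L ^ 2))) * ∑ l ∈ Finset.range (k i), ((F.P Kt).L : ℝ) ^ l) + ((3 * ((F.P Kt).d * (((F.P Kt).L - 1) / 2)) + 5 : ℕ) : ℝ) * ρn i))))) * (2 + Cρ i * (C₂ i * max ((max (ρn i) ((((2 * (∑ l ∈ Finset.range (k i + 1), ((F.P Kt).d * (((F.P Kt).L ^ l - 1) / 2) + 1)) + 1 + (3 * ((F.P Kt).d * (((F.P Kt).L - 1) / 2)) + 5) * (F.P Kt).L ^ (k i) : ℕ) : ℝ)) ^ 2 / 4 * (ν.εreg * (F.P Kt).eta 0 ^ 2) + ((3 * ((F.P Kt).d * (((F.P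 Kt).L - 1) / 2)) + 5 : ℕ) : ℝ) * (6 * ((((((F.P Kt).d + 2) * (F.P Kt).L : ℕ) : ℝ) ^ 2 / 4) * (2 * (ν.εreg * (F.P Kt).L ^ 2))) * ∑ l ∈ Finset.range (k i), ((F.P Kt).L : ℝ) ^ l) + ((3 * ((F.P Kt).d * (((F.P Kt).L - 1) / 2)) + 5 : ℕ) : ℝ) * ρn i))) ((max (ρn i) ((((2 * (∑ l ∈ Finset.range (k i + 1), ((F.P Kt).d * (((F.P Kt).L ^ l - 1) / 2) + 1)) + 1 + (3 * ((F.P Kt).d * (((F.P Kt).L - 1) / 2)) + 5) * (F.P Kt).L ^ (k i) : ℕ) : ℝ)) ^ 2 / 4 * (ν.εreg * (F.P Kt).eta 0 ^ 2) + ((3 * ((F.P Kt).d * (((F.P Kt).L - 1) / 2)) + 5 : ℕ) : ℝ) * (6 * ((((((F.P Kt).d + 2) * (F.P Kt).L : ℕ) : ℝ) ^ 2 / 4) * (2 * (ν.εreg * (F.P Kt).L ^ 2))) * ∑ l ∈ Finset.range (k i), ((F.P Kt).L : ℝ) ^ l) + ((3 * ((F.P Kt).d * (((F.P Kt).L - 1)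 / 2)) + 5 : ℕ) : ℝ) * ρn i))))))
        * (12 * 𝓐₀ i / R i * Real.sqrt (Nat.card {b : PBond (F.P Kt) 0 // b.src ∈ maxDomT ν.M₁ (Z i) 1})) ^ 2
        + 16 * (((F.P Kt).d : ℝ) + 1) * (Cτ i * max ((max (ρn i) ((((2 * (∑ l ∈ Finset.range (k i + 1), ((F.P Kt).d * (((F.P Kt).L ^ l - 1) / 2) + 1)) + 1 + (3 * ((F.P Kt).d * (((F.P Kt).L - 1) / 2)) + 5) * (F.P Kt).L ^ (k i) : ℕ) : ℝ)) ^ 2 / 4 * (ν.εreg * (F.P Kt).eta 0 ^ 2) + ((3 * ((F.P Kt).d * (((F.P Kt).L - 1) / 2)) + 5 : ℕ) : ℝ) * (6 * ((((((F.P Kt).d + 2) * (F.P Kt).L : ℕ) : ℝ) ^ 2 / 4) * (2 * (ν.εreg * (F.P Kt).L ^ 2))) * ∑ l ∈ Finset.range (k i), ((F.P Kt).L : ℝ) ^ l) + ((3 * ((F.P Kt).d * (((F.P Kt).L - 1) / 2)) + 5 : ℕ) : ℝ) * ρn i))) ((max (ρn i) ((((2 * (∑ l ∈ Finset.range (k i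 + 1), ((F.P Kt).d * (((F.P Kt).L ^ l - 1) / 2) + 1)) + 1 + (3 * ((F.P Kt).d * (((F.P Kt).L - 1) / 2)) + 5) * (F.P Kt).L ^ (k i) : ℕ) : ℝ)) ^ 2 / 4 * (ν.εreg * (F.P Kt).eta 0 ^ 2) + ((3 * ((F.P Kt).d * (((F.P Kt).L - 1) / 2)) + 5 : ℕ) : ℝ) * (6 * ((((((F.P Kt).d + 2) * (F.P Kt).L : ℕ) : ℝ) ^ 2 / 4) * (2 * (ν.εreg * (F.P Kt).L ^ 2))) * ∑ l ∈ Finset.range (k i), ((F.P Kt).L : ℝ) ^ l) + ((3 * ((F.P Kt).d * (((F.P Kt).L - 1) / 2)) + 5 : ℕ) : ℝ) * ρn i))))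
      ≤ 1 / (2 * (3 * (K i : ℝ) ^ 2 + 2 * (K i : ℝ) ^ 4)))
    (hγle : ∀ i, γ / (M i) ^ 5 ≤ 1 / (2 * (3 * (K i : ℝ) ^ 2 + 2 * (K i : ℝ) ^ 4)))
    (hfar : ∀ i (b : PBond (F.P Kt) 0), b.src ∉ maxDomT ν.M₁ (Z i) 1 →
      (⟨blockIter (k i) b.src, b.dir⟩ : PBond (F.P Kt) (k i)) ∉ bondsOf (pts (k i) (Λ i)))
    (hZblk : ∀ i, IsBlockUnion (k i) (Z i))
    (hM2 : 2 ≤ ν.M₁) (hdiv : ∀ i, side (F.P Kt).L ν.M₁ (k i) ∣ (F.P Kt).sitesPerDir 0)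
    {cE B₃ a₀ a₁' cA : ℝ} (hcE0 : 0 ≤ cE) (hcE : ∀ i, 12 * ((F.P Kt).d : ℝ) * ((n i : ℝ) + 2) ^ 2 ≤ cE) (hB₃ : 0 ≤ B₃)
    (heRa : ∀ i, (cE + 1) * eR i ≤ a₁' ∧ B₃ * ((cE + 1) * eR i) ≤ ν.εreg) (ha₀ : ν.εreg ≤ a₀)
    (hcA : 1 / 2 * (B₃ * (cE + 1) * (F.P Kt).eta 1 ^ 2) ^ 2 * (Fintype.card (Plaq (F.P Kt) 0) : ℝ) ≤ cA)
    (h15T : ∀ (k' : ℕ), k' ≤ (F.P Kt).m + (F.P Kt).K → side (F.P Kt).L ν.M₁ k' ∣ (F.P Kt).sitesPerDir 0 →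
      ∀ (s : B14.Eq218Concrete.Seq (fun n : ℕ => Node00.unionsOfCubes (F.P Kt) (side (F.P Kt).L ν.M₁ n)) k'),
      Node00.Sect2.SeqSeparated ν.M₁ s → 0 < ν.M₁ →
      ∀ (ε₀ : ℝ) (δ : ℕ → ℝ), (∀ j, j ≤ k' → 0 < δ j ∧ δ j ≤ a₁' ∧ B₃ * δ j ≤ ε₀) → (∀ j, j < k' → δ j ≤ 2 * δ (j + 1)) →
      (∀ j, j < k' → δ (j + 1) ≤ 2 * δ j) → ε₀ ≤ a₀ →
      ∀ W : MSField (F.P Kt) SU2,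
        Node00.Sect2.DataSmall7PTop (Node00.avOfRecord F 2 Kt) s.Ω (Node00.suppDomOfRecord F ν Kt s.Ω) k' δ W →
        ∀ U₀ : GaugeField (F.P Kt) 0 SU2, IsMinimizer (Node00.avOfRecord F 2 Kt)
            {U | (∀ j, j ≤ k' → PlaqSmallOn (Node00.Sect2.omegaPlaqsTop s.Ω (Node00.suppDomOfRecord F ν Kt s.Ω) j)
                (ε₀ * (F.P Kt).eta j ^ 2) U) ∧
              Node00.Sect2.CoDivClassOnTop s.Ω (Node00.suppDomOfRecord F ν Kt s.Ω) k' ε₀ U}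
            (genSet s.Ω k') W U₀ →
          (∀ j, j ≤ k' → PlaqSmallOn (Node00.Sect2.omegaPlaqsTop s.Ω (Node00.suppDomOfRecord F ν Kt s.Ω) j)
              (B₃ * δ j * (F.P Kt).eta j ^ 2) U₀) ∧
            ∀ j, j ≤ k' → Node00.Sect2.CoDivSmallOn (Node00.Sect2.omegaBondsTop s.Ω (Node00.suppDomOfRecord F ν Kt s.Ω) j)
              (B₃ * δ j * (F.P Kt).eta j ^ 3) U₀)
    (hcJ' : ∀ i, 2 * cA * eR i / R i + 4 * ((Fintype.card (Plaq (F.P Kt) 0) : ℝ) * (1 + 8 * 𝓐₀ i ^ 4)) / (R i * eR i) ≤ cJ)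
    : ∃ a₁ : ι → ℝ, (∀ i, 0 < a₁ i) ∧
      B15.Prop1Printed (lfVarOn su2Chart fun i =>
        InstOn.std (Node00.bgMSCoPOfRecord F 2 ν Kt (k i) (maxDomT ν.M₁ (Z i))) ν.M₁ (Z i) (Λ i) (k i) (M i) (a₁ i)
          (anExt (pts (k i) (Λ i)) (T i)
            (fun177std (Node00.bgMSCoPOfRecord F 2 ν Kt (k i) (maxDomT ν.M₁ (Z i))) ν.M₁ (Z i) (k i)) (ext i)
            (min (1 / 2) (min (R i / 8) (γ / (M i) ^ 5 * (R i / 2) ^ 2 /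
              (48 * (4 * ((Fintype.card (Plaq (F.P Kt) 0) : ℝ) * (1 + 8 * 𝓐₀ i ^ 4)) / R i + 1)))))))
    := by
  have hρn0 : ∀ i, 0 ≤ ρn i := fun i => le_trans (by have := heR i; positivity) (hρn i)
  have hT0 : ∀ i, 0 ≤ max (ρn i) ((((2 * (∑ l ∈ Finset.range (k i + 1), ((F.P Kt).d * (((F.P Kt).L ^ l - 1) / 2) + 1)) + 1 + (3 * ((F.P Kt).d * (((F.P Kt).L - 1) / 2)) + 5) * (F.P Kt).L ^ (k i) : ℕ) : ℝ)) ^ 2 / 4 * (ν.εreg * (F.P Kt).eta 0 ^ 2) + ((3 * ((F.P Kt).d * (((F.P Kt).L - 1) / 2)) + 5 : ℕ) : ℝ) * (6 * ((((((F.P Kt).d + 2) * (F.P Kt).L : ℕ) : ℝ) ^ 2 / 4) * (2 * (ν.εreg * (F.P Kt).L ^ 2))) * ∑ l ∈ Finset.range (k i), ((F.P Kt).L : ℝ) ^ l) + ((3 * ((F.P Kt).d * (((F.P Kt).L - 1) / 2)) + 5 : ℕ) : ℝ) * ρn i) := fun i => (hρn0 i).trans (le_max_left _ _)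
  -- the pinned tolerance is positive: its second branch contains `C₁·εreg·η₀² > 0`
  have hTpos : ∀ i, 0 < max (ρn i) ((((2 * (∑ l ∈ Finset.range (k i + 1), ((F.P Kt).d * (((F.P Kt).L ^ l - 1) / 2) + 1)) + 1 + (3 * ((F.P Kt).d * (((F.P Kt).L - 1) / 2)) + 5) * (F.P Kt).L ^ (k i) : ℕ) : ℝ)) ^ 2 / 4 * (ν.εreg * (F.P Kt).eta 0 ^ 2) + ((3 * ((F.P Kt).d * (((F.P Kt).L - 1) / 2)) + 5 : ℕ) : ℝ) * (6 * ((((((F.P Kt).d + 2) * (F.P Kt).L : ℕ) : ℝ) ^ 2 / 4) * (2 * (ν.εreg * (F.P Kt).L ^ 2))) * ∑ l ∈ Finset.range (k i), ((F.P Kt).L : ℝ) ^ l) + ((3 * ((F.P Kt).d * (((F.P Kt).L - 1) / 2)) + 5 : ℕ) : ℝ) * ρn i) := fun i => by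
    have hη : (0 : ℝ) < (F.P Kt).eta 0 := by rw [show (F.P Kt).eta 0 = 1 from pow_zero _]; exact one_pos
    have h1 : (0 : ℝ) < (((2 * (∑ l ∈ Finset.range (k i + 1), ((F.P Kt).d * (((F.P Kt).L ^ l - 1) / 2) + 1)) + 1 + (3 * ((F.P Kt).d * (((F.P Kt).L - 1) / 2)) + 5) * (F.P Kt).L ^ (k i) : ℕ) : ℝ)) ^ 2 / 4 * (ν.εreg * (F.P Kt).eta 0 ^ 2) := by positivity
    have h2 : (0 : ℝ) ≤ ((3 * ((F.P Kt).d * (((F.P Kt).L - 1) / 2)) + 5 : ℕ) : ℝ) * (6 * ((((((F.P Kt).d + 2) * (F.P Kt).L : ℕ) : ℝ) ^ 2 / 4) * (2 * (ν.εreg * (F.P Kt).L ^ 2))) * ∑ l ∈ Finset.range (k i), ((F.P Kt).L : ℝ) ^ l) := by have := hεpos.le; positivity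
    have h3 : (0 : ℝ) ≤ ((3 * ((F.P Kt).d * (((F.P Kt).L - 1) / 2)) + 5 : ℕ) : ℝ) * ρn i := mul_nonneg (Nat.cast_nonneg _) (hρn0 i)
    exact lt_max_of_lt_right (by linarith)
  refine N12Prop1OfGaugeLetterAndChartConstantsLoc.exists_domain_prop1Printed_lfVarOn_std_su2_box_intrinsic_analytic_atZSeqCoPRecord_ofThm1TorusClass_ofMinimiserFamily_ofGaugeLetterN_ofChartConstantsN_ofCoercive
    ν Kt hd3 h0 Z Λ k M hk0 hk eR heR T lo hi n hn hN hbox hZ hTG0 hN5 K hK1 hKn ext hext hlohi LO HI hLO hHI n' hn' hn'N hR' ρn hρn hγ hcJ hbx hbxM hM hR hMin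
    (δc := fun i => max (ρn i) ((((2 * (∑ l ∈ Finset.range (k i + 1), ((F.P Kt).d * (((F.P Kt).L ^ l - 1) / 2) + 1)) + 1 + (3 * ((F.P Kt).d * (((F.P Kt).L - 1) / 2)) + 5) * (F.P Kt).L ^ (k i) : ℕ) : ℝ)) ^ 2 / 4 * (ν.εreg * (F.P Kt).eta 0 ^ 2) + ((3 * ((F.P Kt).d * (((F.P Kt).L - 1) / 2)) + 5 : ℕ) : ℝ) * (6 * ((((((F.P Kt).d + 2) * (F.P Kt).L : ℕ) : ℝ) ^ 2 / 4) * (2 * (ν.εreg * (F.P Kt).L ^ 2))) * ∑ l ∈ Finset.range (k i), ((F.P Kt).L : ℝ) ^ l) + ((3 * ((F.P Kt).d * (((F.P Kt).L - 1) / 2)) + 5 : ℕ) : ℝ) * ρn i)) (δin := fun i => max (ρn i) ((((2 * (∑ l ∈ Finset.range (k i + 1), ((F.P Kt).d * (((F.P Kt).L ^ l - 1) / 2) + 1)) + 1 + (3 * ((F.P Kt).d * (((F.P Kt).L - 1) / 2)) + 5) * (F.P Kt).L ^ (k i) : ℕ) : ℝ)) ^ 2 / 4 * (ν.εreg * (F.P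 Kt).eta 0 ^ 2) + ((3 * ((F.P Kt).d * (((F.P Kt).L - 1) / 2)) + 5 : ℕ) : ℝ) * (6 * ((((((F.P Kt).d + 2) * (F.P Kt).L : ℕ) : ℝ) ^ 2 / 4) * (2 * (ν.εreg * (F.P Kt).L ^ 2))) * ∑ l ∈ Finset.range (k i), ((F.P Kt).L : ℝ) ^ l) + ((3 * ((F.P Kt).d * (((F.P Kt).L - 1) / 2)) + 5 : ℕ) : ℝ) * ρn i)) hT0 hT0 ρs Cμ Cρ C₂ Cτ hCμ hCρ hC₂
    (fun i => ⟨by rw [max_self]; exact hTpos i, by rw [max_self]; exact hsmallT i⟩) h𝓐₀ N ?_ hchartN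
    (fun i => by simpa only [max_self] using hsmT i) hγle hfar hZblk hM2 hdiv hcE0 hcE hB₃ heRa ha₀ hcA h15T hcJ'
  -- (σ)_N at the pinned tolerance: dag-n12-w3's explicit producer, one call per base field and minimiser
  intro i Vk _hV hnV U₀ hU₀
  exact N12GaugeLetterLocExplicit.exists_gaugeLetterLoc_atRecord_explicit ν Kt (hk0 i) (hk i) (hdiv i) (Z i) (hkc i) (hc i) hMrad (hρn0 i)
    (ext i Vk) (boxBonds (LO i) (HI i) : Set (PBond (F.P Kt) (k i))) hnV hU₀ (N i) (hGN i) (hN1 i) hεpos hα3 hα2 haN hM₁ (hGmem i)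

end Summit.QuantumFields.YangMills.BalabanUVNodes.N12Prop1OfGaugeLetterExplicitLoc

end
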